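import Summits.NavierStokesRegularity.NavierStokesRegularity.Theses.RotatedEulerWindow
import HarnessLib.Audit

/-!
# Birth skeleton (BC3) of the crux `RotatedEulerWindow.RotatedWindowCore`

(crux item `stmt-NavierStokesRegularity-19281`, rank 3, route
`route-NavierStokesRegularity-RotatedEulerWindow`; tree path `Cruxes/RotatedWindowCore/Lines/birth.lean`;
registrar `planner-skel-stmt-NavierStokesRegularity-19281-0`, 2026-08-17. The typing seat
`planner-type-8522a5cbc2-0` registered the same three stub signatures with `ledger skeleton check` at
route birth (item evidence `RotatedWindowCore_line.lean`, 2026-08-17T18:37Z) but could not `crux write`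
from its unit; this file publishes that cut as the crux's `Lines/birth.lean` with the stub names and
signatures UNCHANGED, so the registration is continuous. No `Disproof.lean`, no dead lines and no crux
ideas exist for this crux (`ledger crux ls`: no workfiles); negatives index read 2026-08-17.)

THE CRUX (X₃ of the route, NS side; a WEAKENING of VortexLineClock's `TypeIIWindowCore` =
stmt-11272). For `ν, T > 0` and a maximal classical solution `(u,p)` on `[0,T)` that is Leray–Hopf from
a rapidly decaying datum and NOT Type I, there are `(β, α, e, U, Ω)`, `‖e‖ = 1`, with the ROTATED
WINDOW-PROFILE clauses (`2/5 ≤ β < 1/2`; `U ∈ C²`, `Ω ∈ C¹`; `div U = 0`; `mΩ = curl U`, `m > 0`;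
`U, Ω` globally Lipschitz; `∃ c P`, the co-rotating profile system
`(1−β)U + α e×U + DU·V + ∇P = 0`, `DΩ·V − DU·Ω = −Ω − α e×Ω`, `V = β(y−c) − α e×(y−c) + U`;
CIV matched decay `|Ω| ≤ C⟨y⟩^{−1/β}`, `|U| ≤ C⟨y⟩^{1−1/β}`; `‖Ω 0‖ = 1`) AND an Euler-scaling zoom
`t_k ↑ T`, centres `x_k`, amplitudes `A_k = |curl u(t_k)(x_k)| → ∞`, half-max core radii `ℓ_k → 0`,
isometries `Q_k`, local Reynolds numbers `A_k ℓ_k²/ν → ∞`, along which the rescaled vorticity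
`y ↦ A_k⁻¹ Q_k⁻¹ curl u(t_k)(x_k + ℓ_k Q_k y)` converges to `Ω` in `C¹` on every ball.

THE CUT — the route's TWO-LAYER PLAN for this crux ("RotatedWindowCore ⇐ MaxVorticityZoom →
ZoomLimitRelativeEquilibrium → RotMatchedAsymptotics"), i.e. the sibling cut COMPACTNESS | RIGIDITY |
MATCHING of `Cruxes/TypeIIWindowCore/Lines/birth.lean` with the rigidity stub weakened from
"stationary self-similar profile" to "relative equilibrium of the similarity flow (rotation allowed)":

* `stub_maxVorticityZoom` [L; NS-side compactness + inviscid core AT VORTICITY MAXIMA; literally the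
  sibling's stub 1, α-free]: a non-Type-I maximal solution admits a zoom whose centres `x_k` are GLOBAL
  maximum points of `|curl u(t_k)|` (`‖curl u(t_k) z‖ ≤ A_k ∀ z`), with half-max cores `ℓ_k → 0`,
  `A_k → ∞`, `A_k ℓ_k²/ν → ∞`, and a `C¹` limit `Ω`, `‖Ω 0‖ = 1`, of the rescaled vorticity in `C¹` on
  balls. Ingredients: BKM continuation, Constantin's a-priori `L¹` vorticity bound (`ℓ_k³ A_k ≲ ‖ω‖_{L¹}`
  ⇒ `ℓ_k → 0`), parabolic `C^{1,α}` estimates in the rescaled frame (rescaled vorticity ≤ 1 globally at a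
  maximum), Arzelà–Ascoli + diagonal subsequence. Why it might fail: the core at the vorticity maximum may
  stay at Kolmogorov thickness (`A_k ℓ_k² ≲ ν`) while `‖u‖_∞` outruns the Type-I rate by accumulation, or
  `‖∇ω‖ ≫ A_k/ℓ_k` in the core (no `C¹` compactness). The MAX clause is load-bearing for stub 2 (without
  it, far-out zooms converge to a homogeneous blow-down with `U ≡ 0`).
* `stub_zoomLimitRelativeEquilibrium` [XL; OPEN — the load-bearing bet, ASYMPTOTIC RELATIVE
  SELF-SIMILARITY]: along ANY max-centred zoom of a non-Type-I maximal Leray–Hopf solution whose rescaled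
  vorticity converges in `C¹_loc` to `Ω`, the limit is the normalised vorticity of an EXACT RELATIVE
  EQUILIBRIUM of the Euler similarity flow in the window: `∃ β ∈ [2/5, 1/2)`, `α ∈ ℝ`, a unit vector `e`,
  `U ∈ C²`, `div U = 0`, `mΩ = curl U` (`m > 0`), `c`, `P ∈ C¹` with the co-rotating profile system
  (arXiv:2607.09619 (1.7)–(1.8) at ν = 0; the α = 0 slice is CIV arXiv:2602.17570 (3.3)/(3.4)). This
  WEAKENS the sibling's `stub_zoomLimitSelfSimilar` (which forces α = 0). Nearest print: Seregin
  arXiv:2304.04045 Prop. 1.2 (Euler-scaled limits of Type-II blow-ups are local-energy ANCIENT weak Euler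
  solutions — no profile); CIV Prop. 3.1. Why it might fail: the ancient Euler limit may be DSS-but-not-RSS
  (a relative PERIODIC orbit rather than a relative equilibrium), translating, multiscale (Hou/Tao-type
  cascades) or merely bounded-vorticity eternal.
* `stub_rotMatchedAsymptotics` [M/L; CIV MATCHING — the clauses the Euler side consumes]: for any such
  zoom/limit and any `(β, α, e, U, c, P)` as produced by the previous stub, `U` and `Ω` are globally
  Lipschitz and obey the matched decay `|Ω(y)| ≤ C(1+|y|)^{−1/β}`, `|U(y)| ≤ C(1+|y|)^{1−1/β}` (CIV (3.7):
  matching to the regular outer flow; the rotation `e^{−α log(T−t) e×}` is an isometry and does not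
  change the decay rates). Exactly what `DecayFluxRecurrence` (flux through `S_R` is `O(R^{2−1/β}) → 0`)
  and `ProfileClockNoCycle` (Yorke's bound needs `Lip Ω < ∞`) consume on the Euler side. Why it might
  fail: a non-isolated singular set at time `T` breaks matching along its tangent directions; global
  Lipschitz control of `DΩ` is not automatic from local `C¹` convergence; for α ≠ 0 the velocity profile
  grows like `|y|^{1−1/β}` only after subtracting the rigid rotation, which the clause already does
  (`V` carries `−α e×(y−c)`, `U` is the remainder).

`RotatedWindowCore_of : Theses.RotatedEulerWindow.RotatedWindowCore` — the ONLY theorem of this file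
concluding the crux, BY NAME, no `Prop` hypotheses — is the composition: zoom and limit from stub 1,
window exponent, rotation data and exact profile from stub 2, Lipschitz/decay from stub 3, reassembled in
the crux's clause order (the MAX clause of the zoom is dropped).

Disproof used: none exists (no `Disproof.lean` for this crux). As for the sibling, `NoTypeII → crux` holds
ex falso (every NS-side statement conditioned on a non-Type-I blow-up is a consequence of regularity),
which is why the BC3 probes are run against the crux and the summit. No stub is an instance of a refuted
statement (negatives index 2026-08-17: none on zooms / self-similar or rotating profiles).
-/

noncomputable section

open Set Filter Topology Function Metric
open Literature.Analysis.FluidPDE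

namespace Summit.NavierStokesRegularity.NavierStokesRegularity.Cruxes.RotatedWindowCore.Birth

set_option linter.unusedVariables false
set_option linter.dupNamespace false

local notation "ℝ³" => EuclideanSpace ℝ (Fin 3)

/-- **stub 1 — `stub_maxVorticityZoom` (L; NS compactness + inviscid core at vorticity maxima).**
A maximal classical solution on `[0,T)`, Leray–Hopf from a rapidly decaying datum, NOT Type I, admits a
zoom `(t_k, x_k, A_k, ℓ_k, Q_k)` with `x_k` a GLOBAL maximum point of `‖curl u(t_k)‖`
(`‖curl u(t_k) z‖ ≤ A_k` for all `z`), `t_k ∈ [0,T)`, `t_k → T`, `A_k → ∞`, half-max core radii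
`ℓ_k → 0`, local Reynolds numbers `A_k ℓ_k² / ν → ∞`, and a `C¹` field `Ω` with `‖Ω 0‖ = 1` to which the
rescaled vorticity `y ↦ A_k⁻¹ Q_k⁻¹ curl u(t_k)(x_k + ℓ_k Q_k y)` converges in `C¹` on every ball.
(Identical to the sibling stub of `Cruxes/TypeIIWindowCore/Lines/birth.lean`; rotation-free.)
Sources: Beale–Kato–Majda 1984 (continuation), Constantin 1990 (`L¹` vorticity bound), Seregin
arXiv:2304.04045 (Euler scaling of Type II), CIV arXiv:2602.17570 §3.1. -/
theorem stub_maxVorticityZoom :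
    ∀ (ν T : ℝ), 0 < ν → 0 < T → ∀ (u : ℝ → ℝ³ → ℝ³) (p : ℝ → ℝ³ → ℝ),
      IsMaximalSmoothSolution ν 0 u p T → IsLerayHopfOn T ν 0 (u 0) u →
      HasRapidSpatialDecay (u 0) → ¬ IsTypeIBlowup u T →
      ∃ Ω : ℝ³ → ℝ³, ContDiff ℝ 1 Ω ∧ ‖Ω 0‖ = 1 ∧
        ∃ (t : ℕ → ℝ) (x : ℕ → ℝ³) (A ℓ : ℕ → ℝ) (Q : ℕ → (ℝ³ ≃ₗᵢ[ℝ] ℝ³)),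
          (∀ k z, ‖curl (u (t k)) z‖ ≤ A k) ∧
          ((∀ k, 0 ≤ t k ∧ t k < T) ∧ Tendsto t atTop (𝓝 T) ∧ (∀ k, 0 < A k ∧ 0 < ℓ k) ∧
            Tendsto A atTop atTop ∧ Tendsto ℓ atTop (𝓝 0) ∧
            (∀ k, ‖curl (u (t k)) (x k)‖ = A k) ∧
            (∀ k, (∀ z, dist z (x k) < ℓ k → A k / 2 < ‖curl (u (t k)) z‖) ∧
              ∃ z, dist z (x k) = ℓ k ∧ ‖curl (u (t k)) z‖ ≤ A k / 2) ∧
            Tendsto (fun k => A k * ℓ k ^ 2 / ν) atTop atTop ∧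
            ∀ R ε : ℝ, 0 < R → 0 < ε → ∃ k₀ : ℕ, ∀ k ≥ k₀, ∀ y : ℝ³, ‖y‖ ≤ R →
              ‖(A k)⁻¹ • (Q k).symm (curl (u (t k)) (x k + ℓ k • Q k y)) - Ω y‖ +
                ‖fderiv ℝ (fun y' => (A k)⁻¹ • (Q k).symm (curl (u (t k)) (x k + ℓ k • Q k y'))) y -
                  fderiv ℝ Ω y‖ ≤ ε) := by
  sorry

/-- **stub 2 — `stub_zoomLimitRelativeEquilibrium` (XL; OPEN — asymptotic RELATIVE self-similarity,
the load-bearing bet).** Along ANY zoom of a non-Type-I maximal Leray–Hopf classical solution from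
rapidly decaying data which is centred at global vorticity maxima, has half-max cores `ℓ_k → 0`,
`A_k → ∞`, `A_k ℓ_k²/ν → ∞`, and whose rescaled vorticity converges in `C¹` on balls to a `C¹` field
`Ω`, the limit is the normalised vorticity of an EXACT RELATIVE EQUILIBRIUM of the Euler similarity flow
in the window: `‖e‖ = 1`, `2/5 ≤ β < 1/2`, `α : ℝ` (unrestricted), `U ∈ C²`, `div U = 0`,
`m Ω = curl U` for some `m > 0`, and for some centre `c` and `C¹` pressure `P`,
`(1−β)U + α e×U + DU(β(y−c) − α e×(y−c) + U) + ∇P = 0` and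
`DΩ(β(y−c) − α e×(y−c) + U) − DU Ω = −Ω − α e×Ω` (arXiv:2607.09619 (1.7)–(1.8) at ν = 0; α = 0 is
CIV arXiv:2602.17570 (3.3)–(3.4)). Weakens the sibling's `stub_zoomLimitSelfSimilar` (α = 0 forced).
Nearest print: Seregin arXiv:2304.04045 Prop. 1.2 (ancient weak Euler limit only); CIV Prop. 3.1. -/
theorem stub_zoomLimitRelativeEquilibrium :
    ∀ (ν T : ℝ), 0 < ν → 0 < T → ∀ (u : ℝ → ℝ³ → ℝ³) (p : ℝ → ℝ³ → ℝ),
      IsMaximalSmoothSolution ν 0 u p T → IsLerayHopfOn T ν 0 (u 0) u →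
      HasRapidSpatialDecay (u 0) → ¬ IsTypeIBlowup u T →
      ∀ (Ω : ℝ³ → ℝ³) (t : ℕ → ℝ) (x : ℕ → ℝ³) (A ℓ : ℕ → ℝ) (Q : ℕ → (ℝ³ ≃ₗᵢ[ℝ] ℝ³)),
        ContDiff ℝ 1 Ω → (∀ k z, ‖curl (u (t k)) z‖ ≤ A k) →
        ((∀ k, 0 ≤ t k ∧ t k < T) ∧ Tendsto t atTop (𝓝 T) ∧ (∀ k, 0 < A k ∧ 0 < ℓ k) ∧
            Tendsto A atTop atTop ∧ Tendsto ℓ atTop (𝓝 0) ∧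
            (∀ k, ‖curl (u (t k)) (x k)‖ = A k) ∧
            (∀ k, (∀ z, dist z (x k) < ℓ k → A k / 2 < ‖curl (u (t k)) z‖) ∧
              ∃ z, dist z (x k) = ℓ k ∧ ‖curl (u (t k)) z‖ ≤ A k / 2) ∧
            Tendsto (fun k => A k * ℓ k ^ 2 / ν) atTop atTop ∧
            ∀ R ε : ℝ, 0 < R → 0 < ε → ∃ k₀ : ℕ, ∀ k ≥ k₀, ∀ y : ℝ³, ‖y‖ ≤ R →
              ‖(A k)⁻¹ • (Q k).symm (curl (u (t k)) (x k + ℓ k • Q k y)) - Ω y‖ +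
                ‖fderiv ℝ (fun y' => (A k)⁻¹ • (Q k).symm (curl (u (t k)) (x k + ℓ k • Q k y'))) y -
                  fderiv ℝ Ω y‖ ≤ ε) →
        ∃ (β α : ℝ) (e : ℝ³) (U : ℝ³ → ℝ³), ‖e‖ = 1 ∧ (2 / 5 : ℝ) ≤ β ∧ β < 1 / 2 ∧ ContDiff ℝ 2 U ∧
          VectorCalculus.IsDivFree U ∧ (∃ m : ℝ, 0 < m ∧ ∀ y, m • Ω y = curl U y) ∧
          ∃ (c : ℝ³) (P : ℝ³ → ℝ), ContDiff ℝ 1 P ∧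
            (∀ y, (1 - β) • U y + α • cross e (U y) +
                fderiv ℝ U y (β • (y - c) - α • cross e (y - c) + U y) + gradient P y = 0) ∧
            (∀ y, fderiv ℝ Ω y (β • (y - c) - α • cross e (y - c) + U y) - fderiv ℝ U y (Ω y) =
                -(Ω y) - α • cross e (Ω y)) := by
  sorry

/-- **stub 3 — `stub_rotMatchedAsymptotics` (M/L; CIV matching — global Lipschitz bounds and matched
decay of a zoom-limit relative-equilibrium profile).** For any zoom/limit as in stub 2 and any
`(β, α, e, U, c, P)` satisfying its conclusion (`‖e‖ = 1`, `2/5 ≤ β < 1/2`, `U ∈ C²`, `div U = 0`,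
`mΩ = curl U`, `P ∈ C¹`, the two co-rotating profile equations), `U` and `Ω` are globally Lipschitz and
`‖Ω y‖ ≤ C (1+‖y‖)^{−1/β}`, `‖U y‖ ≤ C (1+‖y‖)^{1−1/β}` (CIV arXiv:2602.17570 (3.7): matching to the
regular outer flow; finite energy of the Leray–Hopf solution; the log-time rotation is an isometry and
leaves the rates unchanged). These are exactly the clauses `DecayFluxRecurrence` and `ProfileClockNoCycle`
consume on the Euler side of the route. -/
theorem stub_rotMatchedAsymptotics :
    ∀ (ν T : ℝ), 0 < ν → 0 < T → ∀ (u : ℝ → ℝ³ → ℝ³) (p : ℝ → ℝ³ → ℝ),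
      IsMaximalSmoothSolution ν 0 u p T → IsLerayHopfOn T ν 0 (u 0) u →
      HasRapidSpatialDecay (u 0) → ¬ IsTypeIBlowup u T →
      ∀ (Ω : ℝ³ → ℝ³) (t : ℕ → ℝ) (x : ℕ → ℝ³) (A ℓ : ℕ → ℝ) (Q : ℕ → (ℝ³ ≃ₗᵢ[ℝ] ℝ³)),
        ContDiff ℝ 1 Ω → (∀ k z, ‖curl (u (t k)) z‖ ≤ A k) →
        ((∀ k, 0 ≤ t k ∧ t k < T) ∧ Tendsto t atTop (𝓝 T) ∧ (∀ k, 0 < A k ∧ 0 < ℓ k) ∧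
            Tendsto A atTop atTop ∧ Tendsto ℓ atTop (𝓝 0) ∧
            (∀ k, ‖curl (u (t k)) (x k)‖ = A k) ∧
            (∀ k, (∀ z, dist z (x k) < ℓ k → A k / 2 < ‖curl (u (t k)) z‖) ∧
              ∃ z, dist z (x k) = ℓ k ∧ ‖curl (u (t k)) z‖ ≤ A k / 2) ∧
            Tendsto (fun k => A k * ℓ k ^ 2 / ν) atTop atTop ∧
            ∀ R ε : ℝ, 0 < R → 0 < ε → ∃ k₀ : ℕ, ∀ k ≥ k₀, ∀ y : ℝ³, ‖y‖ ≤ R →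
              ‖(A k)⁻¹ • (Q k).symm (curl (u (t k)) (x k + ℓ k • Q k y)) - Ω y‖ +
                ‖fderiv ℝ (fun y' => (A k)⁻¹ • (Q k).symm (curl (u (t k)) (x k + ℓ k • Q k y'))) y -
                  fderiv ℝ Ω y‖ ≤ ε) →
        ∀ (β α : ℝ) (e : ℝ³) (U : ℝ³ → ℝ³) (c : ℝ³) (P : ℝ³ → ℝ), ‖e‖ = 1 → (2 / 5 : ℝ) ≤ β →
          β < 1 / 2 → ContDiff ℝ 2 U → VectorCalculus.IsDivFree U →
          (∃ m : ℝ, 0 < m ∧ ∀ y, m • Ω y = curl U y) → ContDiff ℝ 1 P →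
          (∀ y, (1 - β) • U y + α • cross e (U y) +
              fderiv ℝ U y (β • (y - c) - α • cross e (y - c) + U y) + gradient P y = 0) →
          (∀ y, fderiv ℝ Ω y (β • (y - c) - α • cross e (y - c) + U y) - fderiv ℝ U y (Ω y) =
              -(Ω y) - α • cross e (Ω y)) →
          (∃ L : NNReal, LipschitzWith L U ∧ LipschitzWith L Ω) ∧
            ∃ C : ℝ, ∀ y, ‖Ω y‖ ≤ C * (1 + ‖y‖) ^ (-(1 / β)) ∧ ‖U y‖ ≤ C * (1 + ‖y‖) ^ (1 - 1 / β) := by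
  sorry

/-- **Birth composition (the skeleton theorem).** The crux BY NAME from the three registered stubs,
used by name: zoom at vorticity maxima with its `C¹_loc` limit `Ω` (stub 1); window exponent `β`,
rotation rate `α`, axis `e`, velocity profile `U`, centre `c` and pressure `P` solving the co-rotating
profile system with `mΩ = curl U` (stub 2); global Lipschitz bounds and matched decay (stub 3);
reassembled in the crux's clause order (the MAX clause of the zoom is dropped). -/
theorem RotatedWindowCore_of : Theses.RotatedEulerWindow.RotatedWindowCore := by
  have h1 := stub_maxVorticityZoom
  have h2 := stub_zoomLimitRelativeEquilibrium
  have h3 := stub_rotMatchedAsymptotics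
  intro ν T hν hT u p hmax hLH hdec hnI
  -- stub 1: the max-centred inviscid zoom and its C¹ limit Ω
  obtain ⟨Ω, hΩ, hΩ0, t, x, A, ℓ, Q, hM, hZ⟩ := h1 ν T hν hT u p hmax hLH hdec hnI
  -- stub 2: the limit is an exact relative equilibrium of the Euler similarity flow in the window
  obtain ⟨β, α, e, U, he, hβl, hβu, hU, hdiv, hcurl, c, P, hP, hE1, hE2⟩ :=
    h2 ν T hν hT u p hmax hLH hdec hnI Ω t x A ℓ Q hΩ hM hZ
  -- stub 3: matched asymptotics (global Lipschitz + CIV decay)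
  obtain ⟨hLip, hdecay⟩ :=
    h3 ν T hν hT u p hmax hLH hdec hnI Ω t x A ℓ Q hΩ hM hZ β α e U c P he hβl hβu hU hdiv hcurl hP
      hE1 hE2
  exact ⟨β, α, e, U, Ω, he, ⟨hβl, hβu, hU, hΩ, hdiv, hcurl, hLip, ⟨c, P, hP, hE1, hE2⟩, hdecay, hΩ0⟩,
    t, x, A, ℓ, Q, hZ⟩

end Summit.NavierStokesRegularity.NavierStokesRegularity.Cruxes.RotatedWindowCore.Birth
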